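import Literature.NumberTheory.Sieve.SmoothLocalBehaviourRegimes
import HarnessLib

/-!
# Hildebrand–Tenenbaum's Theorem 3, reduced to the range of very small `y`

Topic `Literature/NumberTheory/Sieve`; a PROVED reduction toward `Literature.NumberTheory.Sieve.HTLocalBehaviour`
([HildebrandTenenbaum1986, Thm 3]: `Ψ(cx, y) = Ψ(x, y) c^{α(x,y)} (1 + O(1/u + log y/y))` uniformly for
`x ≥ y ≥ 2`, `1 ≤ c ≤ y`). The local behaviour is PROVED in the tree in the ranges

* bounded `u = log x/log y ≤ u₀` (`exists_smallU`: the error factor is `≫ 1` there),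
* `u₀ ≤ u`, `u³ ≤ log y` (`exists_local_smallU`, de Bruijn–Hildebrand),
* `u ≥ (log log y)³`, `8 (log x)³ ≤ y` (`exists_local_regimeA`, the saddle-point theorem in its
  polylogarithmic range),
* bounded `y` (trivially, the error factor being `≫ 1`),

which together cover all `x ≥ y ≥ 2` except the range of very small `y < 8 (log x)³` (with `u` large). This
file assembles them: `HTLocalBehaviour_of_smallY` — the local behaviour in the range `y < 8 (log x)³` implies
`HTLocalBehaviour`.

## References

* [HildebrandTenenbaum1986] A. Hildebrand, G. Tenenbaum, Trans. AMS 296 (1986) 265–290, Theorem 3, §6.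
-/

noncomputable section

open Real Filter

namespace Literature.NumberTheory.Sieve

/-- Eventually `(log L)⁹ ≤ L`. [folklore] -/
theorem eventually_log_pow_nine_le : ∀ᶠ L : ℝ in atTop, Real.log L ^ 9 ≤ L := by
  have h := (isLittleO_log_rpow_rpow_atTop 9 (show (0 : ℝ) < 1 by norm_num)).bound (show (0 : ℝ) < 1 by norm_num)
  filter_upwards [h, eventually_ge_atTop 1] with L hL hL1
  have hl0 : 0 ≤ Real.log L := Real.log_nonneg hL1
  rw [Real.rpow_one, one_mul, Real.norm_of_nonneg (Real.rpow_nonneg hl0 _), Real.norm_of_nonneg (by linarith)] at hL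
  have h3 : Real.log L ^ (9 : ℝ) = Real.log L ^ 9 := by norm_cast
  rwa [h3] at hL

set_option maxHeartbeats 1600000 in
/-- **Theorem 3 from its small-`y` range.** If the local behaviour
`|Ψ(cx, y) - c^{α(x,y)} Ψ(x, y)| ≤ C (log y/log x + log y/y) c^{α(x,y)} Ψ(x, y)` holds for `y ≥ y₀`, `y ≤ x`,
`y < 8 (log x)³`, `1 ≤ c ≤ y`, then it holds for all `x ≥ y ≥ 2`, `1 ≤ c ≤ y`, i.e. `HTLocalBehaviour`
(the other ranges being proved: `exists_smallU`, `exists_local_smallU`, `exists_local_regimeA`, bounded `y`).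
[cite: HildebrandTenenbaum1986, Theorem 3 and §6] -/
theorem HTLocalBehaviour_of_smallY
    (hB : ∃ C : ℝ, ∃ y₀ : ℕ, ∀ (x : ℝ) (y : ℕ) (c : ℝ), y₀ ≤ y → (y : ℝ) ≤ x →
      (y : ℝ) < 8 * Real.log x ^ 3 → 1 ≤ c → c ≤ y →
      |((Nat.smoothNumbersUpTo ⌊c * x⌋₊ (y + 1)).card : ℝ) -
          c ^ saddlePoint x y * ((Nat.smoothNumbersUpTo ⌊x⌋₊ (y + 1)).card : ℝ)| ≤
        C * (Real.log y / Real.log x + Real.log y / y) *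
          (c ^ saddlePoint x y * ((Nat.smoothNumbersUpTo ⌊x⌋₊ (y + 1)).card : ℝ))) :
    HTLocalBehaviour := by
  obtain ⟨CB, yB, hBB⟩ := hB
  obtain ⟨KS, yS, uS, hKS, huS1, hSU⟩ := exists_local_smallU
  obtain ⟨KA, yA, uA, hKA, huA1, hRA⟩ := exists_local_regimeA
  set u₀ : ℝ := max uS uA with hu₀
  have hu₀1 : 1 ≤ u₀ := le_trans huS1 (le_max_left _ _)
  obtain ⟨Ks, ys, hKs, hys2, hsmall⟩ := exists_smallU hu₀1
  obtain ⟨Lstar, hLstar⟩ := Filter.eventually_atTop.1 eventually_log_pow_nine_le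
  set y₀ : ℕ := max (max (max yB yS) (max yA ys)) ⌈Real.exp (max Lstar 1)⌉₊ with hy₀
  have hy₀2 : 2 ≤ y₀ := le_trans hys2 (le_trans (le_max_right _ _) (le_trans (le_max_right _ _) (le_max_left _ _)))
  set K₁ : ℝ := ((1 + (y₀ : ℝ)) ^ y₀ + 1) * ((y₀ : ℝ) / Real.log 2) with hK₁
  have hl2 : 0 < Real.log 2 := Real.log_pos one_lt_two
  set Kbig : ℝ := max (max (max KS KA) (max CB ((Ks + 1) * u₀))) K₁ with hKbig
  refine ⟨Kbig, fun x y hy2 hyx c hc1 hcy => ?_⟩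
  have hy2r : (2 : ℝ) ≤ y := by exact_mod_cast hy2
  have hy1 : (1 : ℝ) < y := by linarith
  have hy0 : (0 : ℝ) < y := by linarith
  have hx1 : 1 < x := by linarith
  have hx0 : 0 < x := by linarith
  have hc0 : 0 < c := by linarith
  have hℓ0 : 0 < Real.log y := Real.log_pos hy1
  have hL0 : 0 < Real.log x := Real.log_pos hx1
  set α : ℝ := saddlePoint x y with hα
  have hαpos : 0 < α := saddlePoint_pos hx1 hy2
  have hcα1 : 1 ≤ c ^ α := Real.one_le_rpow hc1 hαpos.le
  set Ψx : ℝ := ((Nat.smoothNumbersUpTo ⌊x⌋₊ (y + 1)).card : ℝ) with hΨxdef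
  set Ψcx : ℝ := ((Nat.smoothNumbersUpTo ⌊c * x⌋₊ (y + 1)).card : ℝ) with hΨcxdef
  have hΨx1 : 1 ≤ Ψx := one_le_card_smoothNumbersUpTo hx1.le y
  have hΨcx0 : 0 ≤ Ψcx := Nat.cast_nonneg _
  have hfac0 : 0 ≤ Real.log y / Real.log x + Real.log y / y := by positivity
  have hfac1 : Real.log y / Real.log x ≤ Real.log y / Real.log x + Real.log y / y := by
    have : 0 ≤ Real.log y / y := by positivity
    linarith
  have hP0 : 0 ≤ c ^ α * Ψx := by positivity
  have hcrude : ∀ B : ℝ, Ψcx ≤ B * (c ^ α * Ψx) → |Ψcx - c ^ α * Ψx| ≤ (B + 1) * (c ^ α * Ψx) := by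
    intro B hB
    calc |Ψcx - c ^ α * Ψx| ≤ |Ψcx| + |c ^ α * Ψx| := abs_sub _ _
      _ = Ψcx + c ^ α * Ψx := by rw [abs_of_nonneg hΨcx0, abs_of_nonneg hP0]
      _ ≤ B * (c ^ α * Ψx) + c ^ α * Ψx := by linarith
      _ = (B + 1) * (c ^ α * Ψx) := by ring
  -- a bound `K (log y/log x) c^α Ψ` with `K ≤ Kbig` suffices
  have hfinish : ∀ K : ℝ, K ≤ Kbig → 0 ≤ K →
      |Ψcx - c ^ α * Ψx| ≤ K * (Real.log y / Real.log x) * (c ^ α * Ψx) →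
      |Ψcx - c ^ α * Ψx| ≤ Kbig * (Real.log y / Real.log x + Real.log y / y) * (c ^ α * Ψx) := by
    intro K hK hK0 h
    refine h.trans (mul_le_mul_of_nonneg_right ?_ hP0)
    exact mul_le_mul hK hfac1 (by positivity) (hK0.trans hK)
  by_cases hy : y₀ ≤ y
  · have hyB : yB ≤ y := le_trans (le_trans (le_trans (le_max_left _ _) (le_max_left _ _)) (le_max_left _ _)) hy
    have hyS : yS ≤ y := le_trans (le_trans (le_trans (le_max_right _ _) (le_max_left _ _)) (le_max_left _ _)) hy
    have hyA : yA ≤ y := le_trans (le_trans (le_trans (le_max_left _ _) (le_max_right _ _)) (le_max_left _ _)) hy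
    have hys : ys ≤ y := le_trans (le_trans (le_trans (le_max_right _ _) (le_max_right _ _)) (le_max_left _ _)) hy
    have hyL : Real.exp (max Lstar 1) ≤ y :=
      le_trans (Nat.le_ceil _) (by exact_mod_cast le_trans (le_max_right _ _) hy)
    have hLstarL : max Lstar 1 ≤ Real.log y := by
      rw [Real.le_log_iff_exp_le hy0]; exact hyL
    set L := Real.log y with hL
    set u := Real.log x / L with hudef
    by_cases hu : u₀ * L ≤ Real.log x
    · have huu₀ : u₀ ≤ u := by rw [hudef, le_div_iff₀ hℓ0]; exact hu
      have huS : uS ≤ u := le_trans (le_max_left _ _) huu₀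
      have huA : uA ≤ u := le_trans (le_max_right _ _) huu₀
      by_cases hu3 : u ^ 3 ≤ L
      · -- the de Bruijn range
        have h := hSU x y c hyS hyx huS hu3 hc1 hcy
        exact hfinish KS (le_trans (le_trans (le_max_left _ _) (le_max_left _ _)) (le_max_left _ _)) hKS.le h
      · push Not at hu3
        -- `(log L)³ ≤ L^{1/3} < u` as `(log L)⁹ ≤ L`
        have hll : Real.log L ^ 3 ≤ u := by
          have h1 : Real.log L ^ 9 ≤ L := hLstar L (le_trans (le_max_left _ _) hLstarL)
          have hl0 : 0 ≤ Real.log L := Real.log_nonneg (le_trans (le_max_right _ _) hLstarL)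
          by_contra h
          push Not at h
          have hu0 : 0 ≤ u := by rw [hudef]; positivity
          have h2 : u ^ 3 < (Real.log L ^ 3) ^ 3 := by
            exact pow_lt_pow_left₀ h hu0 (by norm_num)
          have h3 : (Real.log L ^ 3) ^ 3 = Real.log L ^ 9 := by ring
          linarith
        by_cases h8 : 8 * Real.log x ^ 3 ≤ y
        · have h := hRA x y c hyA hyx h8 huA hll hc1 hcy
          exact hfinish KA (le_trans (le_trans (le_max_right _ _) (le_max_left _ _)) (le_max_left _ _)) hKA.le h
        · push Not at h8
          have h := hBB x y c hyB hyx h8 hc1 hcy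
          refine h.trans (mul_le_mul_of_nonneg_right (mul_le_mul_of_nonneg_right ?_ hfac0) hP0)
          exact le_trans (le_trans (le_max_left _ _) (le_max_right _ _)) (le_max_left _ _)
    · -- small `u`
      push Not at hu
      have h := hsmall x y c hys hyx hu.le hc1 hcy
      have h1 := hcrude Ks h
      have h2 : 1 ≤ u₀ * (Real.log y / Real.log x + Real.log y / y) := by
        have : 1 ≤ u₀ * (Real.log y / Real.log x) := by
          rw [mul_div_assoc', le_div_iff₀ hL0]; linarith
        have : 0 ≤ u₀ * (Real.log y / y) := by positivity
        nlinarith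
      calc |Ψcx - c ^ α * Ψx| ≤ (Ks + 1) * (c ^ α * Ψx) := h1
        _ ≤ (Ks + 1) * (u₀ * (Real.log y / Real.log x + Real.log y / y)) * (c ^ α * Ψx) := by
            refine mul_le_mul_of_nonneg_right ?_ hP0
            exact le_mul_of_one_le_right (by positivity) h2
        _ = (Ks + 1) * u₀ * (Real.log y / Real.log x + Real.log y / y) * (c ^ α * Ψx) := by ring
        _ ≤ Kbig * (Real.log y / Real.log x + Real.log y / y) * (c ^ α * Ψx) := by
            refine mul_le_mul_of_nonneg_right (mul_le_mul_of_nonneg_right ?_ hfac0) hP0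
            exact le_trans (le_trans (le_max_right _ _) (le_max_right _ _)) (le_max_left _ _)
  · -- bounded `y`
    push Not at hy
    have hyy₀ : (y : ℝ) ≤ y₀ := by exact_mod_cast hy.le
    have hc2 : c ≤ 2 ^ y₀ := by
      calc c ≤ y := hcy
        _ ≤ y₀ := hyy₀
        _ ≤ 2 ^ y₀ := by exact_mod_cast (Nat.lt_two_pow_self).le
    have h1 := card_smoothNumbersUpTo_mul_le_pow y₀ hx1.le hc2 y
    have h2 : ((1 : ℝ) + y) ^ y₀ ≤ (1 + (y₀ : ℝ)) ^ y₀ := pow_le_pow_left₀ (by positivity) (by linarith) _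
    have h3 : Ψcx ≤ (1 + (y₀ : ℝ)) ^ y₀ * (c ^ α * Ψx) := by
      calc Ψcx ≤ (1 + (y : ℝ)) ^ y₀ * Ψx := h1
        _ ≤ (1 + (y₀ : ℝ)) ^ y₀ * Ψx := mul_le_mul_of_nonneg_right h2 (by linarith)
        _ ≤ (1 + (y₀ : ℝ)) ^ y₀ * (c ^ α * Ψx) := by
            refine mul_le_mul_of_nonneg_left ?_ (by positivity)
            exact le_mul_of_one_le_left (by linarith) hcα1
    have h4 := hcrude _ h3
    have h5 : 1 ≤ (y₀ : ℝ) / Real.log 2 * (Real.log y / Real.log x + Real.log y / y) := by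
      have hl2y : Real.log 2 ≤ Real.log y := Real.log_le_log two_pos hy2r
      have h6 : 1 ≤ (y₀ : ℝ) / Real.log 2 * (Real.log y / y) := by
        rw [div_mul_div_comm, le_div_iff₀ (by positivity)]
        nlinarith
      have : 0 ≤ (y₀ : ℝ) / Real.log 2 * (Real.log y / Real.log x) := by positivity
      nlinarith
    calc |Ψcx - c ^ α * Ψx| ≤ ((1 + (y₀ : ℝ)) ^ y₀ + 1) * (c ^ α * Ψx) := h4
      _ ≤ ((1 + (y₀ : ℝ)) ^ y₀ + 1) * ((y₀ : ℝ) / Real.log 2 *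
            (Real.log y / Real.log x + Real.log y / y)) * (c ^ α * Ψx) := by
          refine mul_le_mul_of_nonneg_right ?_ hP0
          exact le_mul_of_one_le_right (by positivity) h5
      _ = K₁ * (Real.log y / Real.log x + Real.log y / y) * (c ^ α * Ψx) := by rw [hK₁]; ring
      _ ≤ Kbig * (Real.log y / Real.log x + Real.log y / y) * (c ^ α * Ψx) :=
          mul_le_mul_of_nonneg_right (mul_le_mul_of_nonneg_right (le_max_right _ _) hfac0) hP0

end Literature.NumberTheory.Sieve

end
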